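import Summits.QuantumFields.YangMills.Theorems.UnitScaleTiltProp7VertexPinnedMorreyCell
import Summits.QuantumFields.YangMills.Theorems.UnitScaleTiltProp7TorusHessianLift
import HarnessLib

/-!
# Route `UnitScaleTilt`, crux K1 «MinimiserStabilityRegPr» (stmt-QuantumFields-19200), route-R E′ path (α′) — the sup-row residue (hK), brick (D1-glob) (part 2 of the dictionary):
# THE CENTRE-PINNED `H²` POINCARÉ INEQUALITY ON THE TORUS — `c⁴·Σ_x v(x)² ≤ C_G·(L^k)⁴·Σ_x (Δv)(x)²` for `v` vanishing on the `k`-centres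

Cell `ym3-torus`, D-0154 (3c) twin-width seat `ym-routeR-w2` (gen 5).  THEOREMS ONLY (0 `def`, 0 `sorry`); `--supports stmt-QuantumFields-19200 --as helper`,
count-neutral.  YM₃ on T³ is a ladder rung (R3), not the Clay problem; nothing here claims the stub, the crux, d = 4 or the gap.

THE POINT (★routeR-w3 g5 18:22:37Z interface wish (2) for (D2′)∕(A); ym-routeR-w6 g5 18:22:07Z (D2′) displayed row; LOCATE `ym-routeR-w2/LOCATE-HK-D1-ROWS-routeRw2g5.md`
rows (D1-glob) + (dict)).  The weighted-energy (Agmon) decay of the pinned biharmonic corrector and the form-relative Combes–Thomas bound both consume ONE global input: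
the coercivity of `Δ` squared on site functions vanishing at the `k`-centres `C = range (embIter k)`, at the scale `ℓ = L^k` of the centre lattice.  This file derives it
from the cell inequality ✓ `Prop7VertexPinnedMorreyCell.sum_sq_le_hessian_of_vanish_vertices` through the periodic lift of ✓ `Prop7TorusHessianLift`: the torus is a window
of side `|T^{(0)}| = ℓ·|T^{(k)}|`, the window is tiled by the `|T^{(k)}|^d` corner-cells `c₀ + ℓt + [0,ℓ)^d` (`c₀ = (ℓ−1)∕2`) whose 8 vertices ARE centres, the Hessian boxes
of radius `5ℓ+1` about the corners are covered by `13^d` cells each, every family of translated cells tiles a fundamental domain, and `Σ_x (Δv)² = Σ_x Σ_{μν} (∂_μ∂_νv)²`.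

WHAT IS PROVED (ns `…Theorems.Prop7CentrePinnedHessianPoincare`; flat `LatticeFieldCalculus` letters on `Site P 0`, real fields; `Zd`, `box`, `fdiff`, `gradSq` for the lift).
* §4 `floor_cell`, `ediv_eq_of_mem_cell`, `window_eq_biUnion_cells`, `cells_pairwiseDisjoint`, ★ `sum_window_eq_sum_cells`, ★ `sum_box_le_sum_cells` (any `d`, any corner
  lattice `c₀ + ℓℤ^d`).
* §5 ★ `sum_window_lift_eq` — a window of side `|T^{(0)}|` is a fundamental domain (`Finset.sum_nbij'`).
* §6 `sum_sq_le_sum_cells` (STEP A), `csq4_hessian_lift` (STEP C), `sum_boxes_le` (STEP D, factor `13^d`), ★★★ `sum_sq_le_laplace_sq_of_vanish_centres`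
  (d = 3): `(∀ y, v (embIter k y) = 0) → c⁴·Σ_x (v x)² ≤ (2197·(24·289·24576·46116))·(L^k)⁴·Σ_x (laplace c v x)²`, and the component form
  ★★★ `sum_sq_map_le_laplace_sq_of_vanish_centres` for `V`-valued `v` read through any `π : V →ₗ[ℝ] ℝ` (sum over a basis for Frobenius∕Euclidean norms).
HONEST SCOPE.  Bookkeeping over part 2's analysis; constants ours (`C_G ≈ 1.7·10¹⁶`), far from sharp; level `0` torus with `C = range (embIter k)` (the instantiation of
record) — an abstract centre set needs the corner-net structure and is not claimed.  Not (D2′), not (N), not (A).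

References: M. Giaquinta, *Multiple integrals in the calculus of variations and nonlinear elliptic systems*, Princeton 1983 [Giaquinta1984] (Ch. III §1 pp.64–72);
T. Bałaban, CMP 95 (1984) 17–40 [Balaban1984PropagatorsI] ((1.6), (1.21) pp.18–21); CMP 102 (1985) 277–309 [Balaban1985Variational] (Prop. 7 p.299).
-/

set_option autoImplicit false

noncomputable section

open scoped BigOperators

namespace Summit.QuantumFields.YangMills.Theorems.Prop7CentrePinnedHessianPoincare

open Literature.MathematicalPhysics.QuantumFieldTheory.Balaban1983to89
open LatticeFieldCalculus
open B15DeterminingSets (embIter)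
open B4Eq19LatticeOperators B4Eq19LatticeBoxMeans
open Summit.QuantumFields.YangMills.Theorems.Prop7VertexPinnedMorreyCell (sum_sq_le_hessian_of_vanish_vertices)
open Summit.QuantumFields.YangMills.Theorems.Prop7TorusHessianLift
open Summit.QuantumFields.YangMills.Theorems.Prop7FlatCoercivity (sitesPerDir_zero_eq_pow_mul)
open Finset

variable {P : Params}

/-! ## §4 Cells of side `ℓ` with corners on `c₀ + ℓℤ^d`: floor bookkeeping, the box-by-cells cover, fundamental domains -/

section Cells

variable {d : ℕ}

/-- floor bookkeeping: with `q = (a − c₀) / ℓ` (`ℓ > 0`), `c₀ + ℓq ≤ a < c₀ + ℓq + ℓ`. [folklore] -/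
theorem floor_cell {ℓ : ℤ} (hℓ : 0 < ℓ) (c₀ a : ℤ) : c₀ + ℓ * ((a - c₀) / ℓ) ≤ a ∧ a < c₀ + ℓ * ((a - c₀) / ℓ) + ℓ := by
  have h1 := Int.emod_add_mul_ediv (a - c₀) ℓ
  have h2 := Int.emod_nonneg (a - c₀) hℓ.ne'
  have h3 := Int.emod_lt_of_pos (a - c₀) hℓ
  constructor <;> linarith

/-- converse: `c₀ + ℓq ≤ a < c₀ + ℓq + ℓ` ⟹ `(a − c₀) / ℓ = q`. [folklore] -/
theorem ediv_eq_of_mem_cell {ℓ : ℤ} (hℓ : 0 < ℓ) {c₀ a q : ℤ} (h1 : c₀ + ℓ * q ≤ a) (h2 : a < c₀ + ℓ * q + ℓ) : (a - c₀) / ℓ = q := by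
  have e : a - c₀ = (a - c₀ - ℓ * q) + q * ℓ := by ring
  rw [e, Int.add_mul_ediv_right _ _ hℓ.ne', Int.ediv_eq_zero_of_lt (by linarith) (by linarith), zero_add]

/-- ★ **A FUNDAMENTAL DOMAIN IS THE DISJOINT UNION OF ITS `M^d` CELLS**: for the window `Π_μ [c₀ + ℓs_μ, c₀ + ℓs_μ + ℓM)`,
the half-open cells `Π_μ [c₀ + ℓ(t_μ+s_μ), c₀ + ℓ(t_μ+s_μ) + ℓ)`, `t ∈ [0, M−1]^d`, tile it. [folklore] -/
theorem window_eq_biUnion_cells {ℓ : ℤ} (hℓ : 0 < ℓ) (c₀ : ℤ) (M : ℕ) (s : Zd d) :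
    (Fintype.piFinset fun μ => Finset.Ico (c₀ + ℓ * s μ) (c₀ + ℓ * s μ + ℓ * M))
      = (Fintype.piFinset fun _ : Fin d => Finset.Icc (0 : ℤ) ((M : ℤ) - 1)).biUnion
          (fun t => Fintype.piFinset fun μ => Finset.Ico (c₀ + ℓ * (t μ + s μ)) (c₀ + ℓ * (t μ + s μ) + ℓ)) := by
  ext z
  simp only [Fintype.mem_piFinset, Finset.mem_Ico, Finset.mem_biUnion, Finset.mem_Icc]
  constructor
  · intro hz
    refine ⟨fun μ => (z μ - (c₀ + ℓ * s μ)) / ℓ, fun μ => ⟨?_, ?_⟩, fun μ => ?_⟩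
    · exact Int.ediv_nonneg (by linarith [(hz μ).1]) hℓ.le
    · have : (z μ - (c₀ + ℓ * s μ)) / ℓ < M := by
        rw [Int.ediv_lt_iff_lt_mul hℓ]; linarith [(hz μ).2]
      linarith
    · have h := floor_cell hℓ (c₀ + ℓ * s μ) (z μ)
      constructor <;> nlinarith [h.1, h.2]
  · rintro ⟨t, ht, hz⟩ μ
    obtain ⟨h1, h2⟩ := hz μ
    obtain ⟨h3, h4⟩ := ht μ
    have hM : ℓ * (t μ + 1) ≤ ℓ * M := mul_le_mul_of_nonneg_left (by linarith) hℓ.le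
    constructor <;> nlinarith

/-- the cells of distinct indices are disjoint. [folklore] -/
theorem cells_pairwiseDisjoint {ℓ : ℤ} (hℓ : 0 < ℓ) (c₀ : ℤ) (s : Zd d) (T : Finset (Zd d)) :
    (T : Set (Zd d)).PairwiseDisjoint
      (fun t => Fintype.piFinset fun μ => Finset.Ico (c₀ + ℓ * (t μ + s μ)) (c₀ + ℓ * (t μ + s μ) + ℓ)) := by
  intro t _ t' _ htt'
  rw [Function.onFun, Finset.disjoint_left]
  intro z hz hz'
  apply htt'
  funext μ
  have h1 := (Fintype.mem_piFinset.mp hz) μ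
  have h2 := (Fintype.mem_piFinset.mp hz') μ
  rw [Finset.mem_Ico] at h1 h2
  have e1 : (z μ - c₀) / ℓ = t μ + s μ := ediv_eq_of_mem_cell hℓ (by linarith [h1.1]) (by linarith [h1.2])
  have e2 : (z μ - c₀) / ℓ = t' μ + s μ := ediv_eq_of_mem_cell hℓ (by linarith [h2.1]) (by linarith [h2.2])
  linarith

/-- ★ **WINDOW SUM = SUM OVER CELLS** (disjoint tiling). [folklore] -/
theorem sum_window_eq_sum_cells {ℓ : ℤ} (hℓ : 0 < ℓ) (c₀ : ℤ) (M : ℕ) (s : Zd d) (G : Zd d → ℝ) :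
    ∑ z ∈ (Fintype.piFinset fun μ => Finset.Ico (c₀ + ℓ * s μ) (c₀ + ℓ * s μ + ℓ * M)), G z
      = ∑ t ∈ (Fintype.piFinset fun _ : Fin d => Finset.Icc (0 : ℤ) ((M : ℤ) - 1)),
          ∑ z ∈ (Fintype.piFinset fun μ => Finset.Ico (c₀ + ℓ * (t μ + s μ)) (c₀ + ℓ * (t μ + s μ) + ℓ)), G z := by
  rw [window_eq_biUnion_cells hℓ c₀ M s, Finset.sum_biUnion (cells_pairwiseDisjoint hℓ c₀ s _)]

/-- ★ **A BOX OF RADIUS `5ℓ+1` ABOUT A CORNER IS COVERED BY THE `13^d` NEIGHBOURING CELLS**: for `G ≥ 0`,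
`Σ_{Q_{5ℓ+1}(c₀+ℓt)} G ≤ Σ_{s ∈ [−6,6]^d} Σ_{cell(t+s)} G`. [folklore] -/
theorem sum_box_le_sum_cells {ℓ : ℤ} (hℓ : 0 < ℓ) (c₀ : ℤ) (t : Zd d) (G : Zd d → ℝ) (hG : ∀ z, 0 ≤ G z) :
    ∑ z ∈ box (fun μ => c₀ + ℓ * t μ) (5 * ℓ + 1), G z
      ≤ ∑ s ∈ (Fintype.piFinset fun _ : Fin d => Finset.Icc (-6 : ℤ) 6),
          ∑ z ∈ (Fintype.piFinset fun μ => Finset.Ico (c₀ + ℓ * (t μ + s μ)) (c₀ + ℓ * (t μ + s μ) + ℓ)), G z := by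
  classical
  set B := box (fun μ => c₀ + ℓ * t μ) (5 * ℓ + 1) with hB
  set S := (Fintype.piFinset fun _ : Fin d => Finset.Icc (-6 : ℤ) 6) with hS
  set idx : Zd d → Zd d := fun z μ => (z μ - c₀) / ℓ - t μ with hidx
  have hmaps : ∀ z ∈ B, idx z ∈ S := by
    intro z hz
    rw [hS, Fintype.mem_piFinset]
    intro μ
    rw [Finset.mem_Icc]
    have hzμ := (mem_box.mp hz) μ
    rw [abs_le] at hzμ
    have h := floor_cell hℓ c₀ (z μ)
    simp only [hidx]
    constructor
    · -- `ℓ(q+1) > ℓ(t−5) − 1` ⟹ `q + 1 ≥ t − 5`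
      by_contra hcon
      push Not at hcon
      have : (z μ - c₀) / ℓ + 1 ≤ t μ - 6 := by linarith
      nlinarith [h.2, hzμ.1]
    · by_contra hcon
      push Not at hcon
      have : t μ + 7 ≤ (z μ - c₀) / ℓ := by linarith
      nlinarith [h.1, hzμ.2]
  rw [← Finset.sum_fiberwise_of_maps_to hmaps]
  refine Finset.sum_le_sum fun s' _ => ?_
  refine Finset.sum_le_sum_of_subset_of_nonneg (fun z hz => ?_) fun z _ _ => hG z
  rw [Finset.mem_filter] at hz
  obtain ⟨_, hzs⟩ := hz
  rw [Fintype.mem_piFinset]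
  intro μ
  rw [Finset.mem_Ico]
  have h := floor_cell hℓ c₀ (z μ)
  have e : (z μ - c₀) / ℓ = t μ + s' μ := by
    have := congrFun hzs μ; simp only [hidx] at this; linarith
  rw [e] at h
  exact ⟨h.1, h.2⟩

end Cells

/-! ## §5 The window sums of a lifted torus function are torus sums -/

/-- ★ **A WINDOW OF SIDE `|T^{(0)}|` IS A FUNDAMENTAL DOMAIN**: `Σ_{z ∈ Π_μ [a_μ, a_μ + N)} G(π z) = Σ_{x ∈ T^{(0)}} G(x)`. [folklore] -/
theorem sum_window_lift_eq (a : Zd P.d) (G : Site P 0 → ℝ) :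
    ∑ z ∈ (Fintype.piFinset fun μ => Finset.Ico (a μ) (a μ + P.sitesPerDir 0)), G (fun μ => ((z μ : ℤ) : ZMod (P.sitesPerDir 0)))
      = ∑ x : Site P 0, G x := by
  classical
  set N := P.sitesPerDir 0 with hN
  have hN0 : (0 : ℤ) < (N : ℤ) := by have := NeZero.pos N; exact_mod_cast this
  refine Finset.sum_nbij' (fun z : Zd P.d => (fun μ => ((z μ : ℤ) : ZMod N)))
    (fun x : Site P 0 => fun μ => a μ + (((x μ - ((a μ : ℤ) : ZMod N)).val : ℕ) : ℤ)) ?_ ?_ ?_ ?_ ?_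
  · intro z _; exact Finset.mem_univ _
  · intro x _
    rw [Fintype.mem_piFinset]
    intro μ
    rw [Finset.mem_Ico]
    have := ZMod.val_lt (x μ - ((a μ : ℤ) : ZMod N))
    constructor
    · linarith [Nat.cast_nonneg (α := ℤ) ((x μ - ((a μ : ℤ) : ZMod N)).val)]
    · exact_mod_cast (by omega : a μ + ((x μ - ((a μ : ℤ) : ZMod N)).val : ℤ) < a μ + N)
  · intro z hz
    funext μ
    have h := (Fintype.mem_piFinset.mp hz) μ
    rw [Finset.mem_Ico] at h
    have e : ((z μ : ℤ) : ZMod N) - ((a μ : ℤ) : ZMod N) = (((z μ - a μ : ℤ)) : ZMod N) := by push_cast; ring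
    simp only [e, ZMod.val_intCast]
    rw [Int.emod_eq_of_lt (by linarith) (by linarith)]
    ring
  · intro x _
    funext μ
    push_cast
    rw [ZMod.natCast_zmod_val]
    ring
  · intro z _; rfl


/-! ## §6 ★★★ The centre-pinned `H²` Poincaré inequality on the torus: `c⁴·Σ_x v(x)² ≤ C_G·(L^k)⁴·Σ_x (Δv)(x)²` -/

/-- ★ STEP A — **the torus sum is dominated by the sum over the `M^d` closed corner-cells of the lift**:
`Σ_x v(x)² ≤ Σ_{t ∈ [0,M−1]^d} Σ_{z ∈ c₀+ℓt+[0,ℓ]^d} v(π z)²` (`ℓ = L^k`, `c₀ = (ℓ−1)∕2`, `M = |T^{(k)}|` per direction). [folklore] -/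
theorem sum_sq_le_sum_cells {k : ℕ} (hk : k ≤ P.m + P.K) (v : SiteField P 0 ℝ) :
    ∑ x : Site P 0, (v x) ^ 2
      ≤ ∑ t ∈ (Fintype.piFinset fun _ : Fin P.d => Finset.Icc (0 : ℤ) ((P.sitesPerDir k : ℤ) - 1)),
          ∑ z ∈ (Fintype.piFinset fun i : Fin P.d =>
              Finset.Icc ((((P.L ^ k - 1) / 2 : ℕ) : ℤ) + ((P.L ^ k : ℕ) : ℤ) * t i) ((((P.L ^ k - 1) / 2 : ℕ) : ℤ) + ((P.L ^ k : ℕ) : ℤ) * t i + ((P.L ^ k : ℕ) : ℤ))),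
            (v (fun μ => ((z μ : ℤ) : ZMod (P.sitesPerDir 0)))) ^ 2 := by
  classical
  have hℓpos : (0 : ℤ) < ((P.L ^ k : ℕ) : ℤ) := by exact_mod_cast Nat.one_le_pow k P.L P.L_pos
  have hN : ((P.sitesPerDir 0 : ℕ) : ℤ) = ((P.L ^ k : ℕ) : ℤ) * (P.sitesPerDir k : ℤ) := by
    rw [sitesPerDir_zero_eq_pow_mul hk]; push_cast; ring
  have h1 := sum_window_lift_eq (P := P) (fun _ => (((P.L ^ k - 1) / 2 : ℕ) : ℤ)) (fun x => (v x) ^ 2)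
  have h2 := sum_window_eq_sum_cells (d := P.d) hℓpos (((P.L ^ k - 1) / 2 : ℕ) : ℤ) (P.sitesPerDir k) (fun _ => (0 : ℤ))
    (fun z => (v (fun μ => ((z μ : ℤ) : ZMod (P.sitesPerDir 0)))) ^ 2)
  simp only [mul_zero, add_zero] at h2
  simp only [hN] at h1
  rw [← h1, h2]
  refine Finset.sum_le_sum fun t _ => Finset.sum_le_sum_of_subset_of_nonneg (fun z hz => ?_) fun _ _ _ => sq_nonneg _
  rw [Fintype.mem_piFinset] at hz ⊢
  intro μ
  have := hz μ
  rw [Finset.mem_Ico] at this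
  rw [Finset.mem_Icc]
  exact ⟨this.1, this.2.le⟩

/-- ★ STEP C — `c⁴ ×` (Hessian energy of the lift on a box) `=` the box sum of `F∘π`, `F = Σ_{μν} (∂_ν∂_μ v)²`. [folklore] -/
theorem csq4_hessian_lift (c : ℝ) (v : SiteField P 0 ℝ) (w : Zd P.d) (R : ℤ) :
    c ^ 4 * ∑ μ : Fin P.d, gradSq (fdiff μ (fun z : Zd P.d => v (fun κ => ((z κ : ℤ) : ZMod (P.sitesPerDir 0))))) (box w R)
      = ∑ z ∈ box w R, ∑ μ : Fin P.d, ∑ ν : Fin P.d, (pdiff c ν (pdiff c μ v) (fun κ => ((z κ : ℤ) : ZMod (P.sitesPerDir 0)))) ^ 2 := by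
  simp only [gradSq_def, Finset.mul_sum]
  rw [Finset.sum_comm]
  refine Finset.sum_congr rfl fun z _ => Finset.sum_congr rfl fun μ _ => Finset.sum_congr rfl fun ν _ => ?_
  rw [← csq_fdiff_fdiff_lift c v ν μ z]
  ring

/-- ★ STEP D — **the box sums over all corner-cells are at most `13^d` torus sums**: for `G ≥ 0`,
`Σ_{t ∈ [0,M−1]^d} Σ_{z ∈ Q_{5ℓ+1}(c₀+ℓt)} G(π z) ≤ 13^d · Σ_x G(x)`. [folklore] -/
theorem sum_boxes_le {k : ℕ} (hk : k ≤ P.m + P.K) (G : Site P 0 → ℝ) (hG : ∀ x, 0 ≤ G x) :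
    ∑ t ∈ (Fintype.piFinset fun _ : Fin P.d => Finset.Icc (0 : ℤ) ((P.sitesPerDir k : ℤ) - 1)),
        ∑ z ∈ box (fun μ : Fin P.d => (((P.L ^ k - 1) / 2 : ℕ) : ℤ) + ((P.L ^ k : ℕ) : ℤ) * t μ) (5 * ((P.L ^ k : ℕ) : ℤ) + 1),
          G (fun μ => ((z μ : ℤ) : ZMod (P.sitesPerDir 0)))
      ≤ (13 : ℝ) ^ P.d * ∑ x : Site P 0, G x := by
  classical
  have hℓpos : (0 : ℤ) < ((P.L ^ k : ℕ) : ℤ) := by exact_mod_cast Nat.one_le_pow k P.L P.L_pos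
  have hN : ((P.sitesPerDir 0 : ℕ) : ℤ) = ((P.L ^ k : ℕ) : ℤ) * (P.sitesPerDir k : ℤ) := by
    rw [sitesPerDir_zero_eq_pow_mul hk]; push_cast; ring
  have hcov := fun t : Zd P.d => sum_box_le_sum_cells hℓpos ((((P.L ^ k - 1) / 2 : ℕ) : ℤ)) t
    (fun z => G (fun μ => ((z μ : ℤ) : ZMod (P.sitesPerDir 0)))) (fun z => hG _)
  have hwin := fun s : Zd P.d => sum_window_eq_sum_cells hℓpos ((((P.L ^ k - 1) / 2 : ℕ) : ℤ)) (P.sitesPerDir k) s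
    (fun z => G (fun μ => ((z μ : ℤ) : ZMod (P.sitesPerDir 0))))
  have hlift := fun s : Zd P.d => sum_window_lift_eq (P := P) (fun μ => (((P.L ^ k - 1) / 2 : ℕ) : ℤ) + ((P.L ^ k : ℕ) : ℤ) * s μ) G
  simp only [hN] at hlift
  have hcard : (((Fintype.piFinset fun _ : Fin P.d => Finset.Icc (-6 : ℤ) 6)).card : ℝ) = (13 : ℝ) ^ P.d := by
    rw [Fintype.card_piFinset, Finset.prod_const, Finset.card_univ, Fintype.card_fin]
    simp
  calc ∑ t ∈ (Fintype.piFinset fun _ : Fin P.d => Finset.Icc (0 : ℤ) ((P.sitesPerDir k : ℤ) - 1)),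
        ∑ z ∈ box (fun μ : Fin P.d => (((P.L ^ k - 1) / 2 : ℕ) : ℤ) + ((P.L ^ k : ℕ) : ℤ) * t μ) (5 * ((P.L ^ k : ℕ) : ℤ) + 1),
          G (fun μ => ((z μ : ℤ) : ZMod (P.sitesPerDir 0)))
      ≤ ∑ t ∈ (Fintype.piFinset fun _ : Fin P.d => Finset.Icc (0 : ℤ) ((P.sitesPerDir k : ℤ) - 1)),
          ∑ s ∈ (Fintype.piFinset fun _ : Fin P.d => Finset.Icc (-6 : ℤ) 6),
            ∑ z ∈ (Fintype.piFinset fun μ => Finset.Ico ((((P.L ^ k - 1) / 2 : ℕ) : ℤ) + ((P.L ^ k : ℕ) : ℤ) * (t μ + s μ))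
                ((((P.L ^ k - 1) / 2 : ℕ) : ℤ) + ((P.L ^ k : ℕ) : ℤ) * (t μ + s μ) + ((P.L ^ k : ℕ) : ℤ))),
              G (fun μ => ((z μ : ℤ) : ZMod (P.sitesPerDir 0))) := Finset.sum_le_sum fun t _ => hcov t
    _ = ∑ s ∈ (Fintype.piFinset fun _ : Fin P.d => Finset.Icc (-6 : ℤ) 6),
          ∑ t ∈ (Fintype.piFinset fun _ : Fin P.d => Finset.Icc (0 : ℤ) ((P.sitesPerDir k : ℤ) - 1)),
            ∑ z ∈ (Fintype.piFinset fun μ => Finset.Ico ((((P.L ^ k - 1) / 2 : ℕ) : ℤ) + ((P.L ^ k : ℕ) : ℤ) * (t μ + s μ))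
                ((((P.L ^ k - 1) / 2 : ℕ) : ℤ) + ((P.L ^ k : ℕ) : ℤ) * (t μ + s μ) + ((P.L ^ k : ℕ) : ℤ))),
              G (fun μ => ((z μ : ℤ) : ZMod (P.sitesPerDir 0))) := Finset.sum_comm
    _ = ∑ s ∈ (Fintype.piFinset fun _ : Fin P.d => Finset.Icc (-6 : ℤ) 6), ∑ x : Site P 0, G x := by
        refine Finset.sum_congr rfl fun s _ => ?_
        rw [← hwin s, ← hlift s]
    _ = (13 : ℝ) ^ P.d * ∑ x : Site P 0, G x := by rw [Finset.sum_const, nsmul_eq_mul, hcard]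

/-- ★★★ **(D1-glob) THE CENTRE-PINNED `H²` POINCARÉ INEQUALITY ON THE TORUS `T^{(0)}`** (d = 3): if a real site function `v` vanishes on the `k`-centres
`range (embIter k)` (`k ≤ m + K`), then `c⁴·Σ_x v(x)² ≤ C_G·(L^k)⁴·Σ_x (laplace c v)(x)²` with `C_G = 13³·24·289·24576·46116` (absolute; `c` = the lattice factor of
`LatticeFieldCalculus.laplace`, so the inequality is scale-covariant; for `c = 0` it is trivial).  Proof: STEP A (torus = window = `M³` corner-cells of the periodic lift), the
cell inequality ✓ `Prop7VertexPinnedMorreyCell.sum_sq_le_hessian_of_vanish_vertices` (its 8 vertices `c₀ + ℓ(t+ε)` lift to centres by `cast_mem_range_embIter`), STEP C, STEP D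
(`13³` multiplicity) and the torus identity `sum_laplace_sq`.  Vector∕matrix-valued fields: apply it to each real coordinate `π ∘ v`, `π : V →ₗ[ℝ] ℝ`
(`laplace` commutes with `π`). [cite: Giaquinta1984, Ch. III §1 Thm 1.2 pp.70–72; Balaban1985Variational, Prop. 7 p.299] -/
theorem sum_sq_le_laplace_sq_of_vanish_centres (hd : P.d = 3) {k : ℕ} (hk : k ≤ P.m + P.K) (c : ℝ) (v : SiteField P 0 ℝ)
    (h0 : ∀ y : Site P k, v (embIter k y) = 0) :
    c ^ 4 * ∑ x : Site P 0, (v x) ^ 2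
      ≤ (2197 * (24 * 289 * 24576 * 46116) : ℝ) * ((P.L : ℝ) ^ k) ^ 4 * ∑ x : Site P 0, (laplace c v x) ^ 2 := by
  classical
  have hℓ1 : 1 ≤ P.L ^ k := Nat.one_le_pow k P.L P.L_pos
  have hA := sum_sq_le_sum_cells hk v
  have hD := sum_boxes_le hk (fun x => ∑ μ : Fin P.d, ∑ ν : Fin P.d, (pdiff c ν (pdiff c μ v) x) ^ 2)
    (fun x => Finset.sum_nonneg fun _ _ => Finset.sum_nonneg fun _ _ => sq_nonneg _)
  have hC := fun w : Zd P.d => csq4_hessian_lift c v w (5 * ((P.L ^ k : ℕ) : ℤ) + 1)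
  -- STEP B per cell: the vertex-pinned Morrey–Poincaré inequality of part 2
  have hB : ∀ t : Zd P.d,
      ∑ z ∈ (Fintype.piFinset fun i : Fin P.d =>
          Finset.Icc ((((P.L ^ k - 1) / 2 : ℕ) : ℤ) + ((P.L ^ k : ℕ) : ℤ) * t i) ((((P.L ^ k - 1) / 2 : ℕ) : ℤ) + ((P.L ^ k : ℕ) : ℤ) * t i + ((P.L ^ k : ℕ) : ℤ))),
        (v (fun μ => ((z μ : ℤ) : ZMod (P.sitesPerDir 0)))) ^ 2
      ≤ (24 * 289 * 24576 * 46116 : ℝ) * ((P.L ^ k : ℕ) : ℝ) ^ 4 *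
          ∑ μ : Fin P.d, gradSq (fdiff μ (fun z : Zd P.d => v (fun κ => ((z κ : ℤ) : ZMod (P.sitesPerDir 0)))))
            (box (fun μ : Fin P.d => (((P.L ^ k - 1) / 2 : ℕ) : ℤ) + ((P.L ^ k : ℕ) : ℤ) * t μ) (5 * ((P.L ^ k : ℕ) : ℤ) + 1)) := by
    intro t
    refine sum_sq_le_hessian_of_vanish_vertices hd (fun z : Zd P.d => v (fun κ => ((z κ : ℤ) : ZMod (P.sitesPerDir 0))))
      (fun μ : Fin P.d => (((P.L ^ k - 1) / 2 : ℕ) : ℤ) + ((P.L ^ k : ℕ) : ℤ) * t μ) hℓ1 fun ε => ?_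
    obtain ⟨y, hy⟩ := cast_mem_range_embIter hk
      (fun i => (((P.L ^ k - 1) / 2 : ℕ) : ℤ) + ((P.L ^ k : ℕ) : ℤ) * t i + ((P.L ^ k : ℕ) : ℤ) * ((ε i : ℕ) : ℤ))
      (fun μ => ⟨t μ + ((ε μ : ℕ) : ℤ), by push_cast; ring⟩)
    have h := h0 y
    rw [hy] at h
    exact h
  -- STEP E: `Σ_x F x = Σ_x (Δv)²`
  have hE : ∑ x : Site P 0, ∑ μ : Fin P.d, ∑ ν : Fin P.d, (pdiff c ν (pdiff c μ v) x) ^ 2 = ∑ x : Site P 0, (laplace c v x) ^ 2 := by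
    rw [sum_laplace_sq]
    exact Finset.sum_congr rfl fun x _ => Finset.sum_comm
  -- assembly
  have hc4 : 0 ≤ c ^ 4 := by positivity
  have hK0 : 0 ≤ (24 * 289 * 24576 * 46116 : ℝ) * ((P.L ^ k : ℕ) : ℝ) ^ 4 := by positivity
  have hcast : ((P.L ^ k : ℕ) : ℝ) = (P.L : ℝ) ^ k := by push_cast; ring
  have h3d : (13 : ℝ) ^ P.d = 2197 := by rw [hd]; norm_num
  calc c ^ 4 * ∑ x : Site P 0, (v x) ^ 2
      ≤ c ^ 4 * ∑ t ∈ (Fintype.piFinset fun _ : Fin P.d => Finset.Icc (0 : ℤ) ((P.sitesPerDir k : ℤ) - 1)),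
          ∑ z ∈ (Fintype.piFinset fun i : Fin P.d =>
              Finset.Icc ((((P.L ^ k - 1) / 2 : ℕ) : ℤ) + ((P.L ^ k : ℕ) : ℤ) * t i) ((((P.L ^ k - 1) / 2 : ℕ) : ℤ) + ((P.L ^ k : ℕ) : ℤ) * t i + ((P.L ^ k : ℕ) : ℤ))),
            (v (fun μ => ((z μ : ℤ) : ZMod (P.sitesPerDir 0)))) ^ 2 := mul_le_mul_of_nonneg_left hA hc4
    _ = ∑ t ∈ (Fintype.piFinset fun _ : Fin P.d => Finset.Icc (0 : ℤ) ((P.sitesPerDir k : ℤ) - 1)),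
          c ^ 4 * ∑ z ∈ (Fintype.piFinset fun i : Fin P.d =>
              Finset.Icc ((((P.L ^ k - 1) / 2 : ℕ) : ℤ) + ((P.L ^ k : ℕ) : ℤ) * t i) ((((P.L ^ k - 1) / 2 : ℕ) : ℤ) + ((P.L ^ k : ℕ) : ℤ) * t i + ((P.L ^ k : ℕ) : ℤ))),
            (v (fun μ => ((z μ : ℤ) : ZMod (P.sitesPerDir 0)))) ^ 2 := Finset.mul_sum _ _ _
    _ ≤ ∑ t ∈ (Fintype.piFinset fun _ : Fin P.d => Finset.Icc (0 : ℤ) ((P.sitesPerDir k : ℤ) - 1)),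
          c ^ 4 * ((24 * 289 * 24576 * 46116 : ℝ) * ((P.L ^ k : ℕ) : ℝ) ^ 4 *
            ∑ μ : Fin P.d, gradSq (fdiff μ (fun z : Zd P.d => v (fun κ => ((z κ : ℤ) : ZMod (P.sitesPerDir 0)))))
              (box (fun μ : Fin P.d => (((P.L ^ k - 1) / 2 : ℕ) : ℤ) + ((P.L ^ k : ℕ) : ℤ) * t μ) (5 * ((P.L ^ k : ℕ) : ℤ) + 1))) :=
          Finset.sum_le_sum fun t _ => mul_le_mul_of_nonneg_left (hB t) hc4
    _ = ∑ t ∈ (Fintype.piFinset fun _ : Fin P.d => Finset.Icc (0 : ℤ) ((P.sitesPerDir k : ℤ) - 1)),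
          (24 * 289 * 24576 * 46116 : ℝ) * ((P.L ^ k : ℕ) : ℝ) ^ 4 *
            ∑ z ∈ box (fun μ : Fin P.d => (((P.L ^ k - 1) / 2 : ℕ) : ℤ) + ((P.L ^ k : ℕ) : ℤ) * t μ) (5 * ((P.L ^ k : ℕ) : ℤ) + 1),
              ∑ μ : Fin P.d, ∑ ν : Fin P.d, (pdiff c ν (pdiff c μ v) (fun κ => ((z κ : ℤ) : ZMod (P.sitesPerDir 0)))) ^ 2 :=
          Finset.sum_congr rfl fun t _ => by rw [← hC]; ring
    _ = (24 * 289 * 24576 * 46116 : ℝ) * ((P.L ^ k : ℕ) : ℝ) ^ 4 *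
          ∑ t ∈ (Fintype.piFinset fun _ : Fin P.d => Finset.Icc (0 : ℤ) ((P.sitesPerDir k : ℤ) - 1)),
            ∑ z ∈ box (fun μ : Fin P.d => (((P.L ^ k - 1) / 2 : ℕ) : ℤ) + ((P.L ^ k : ℕ) : ℤ) * t μ) (5 * ((P.L ^ k : ℕ) : ℤ) + 1),
              ∑ μ : Fin P.d, ∑ ν : Fin P.d, (pdiff c ν (pdiff c μ v) (fun κ => ((z κ : ℤ) : ZMod (P.sitesPerDir 0)))) ^ 2 := by
          rw [Finset.mul_sum]
    _ ≤ (24 * 289 * 24576 * 46116 : ℝ) * ((P.L ^ k : ℕ) : ℝ) ^ 4 *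
          ((13 : ℝ) ^ P.d * ∑ x : Site P 0, ∑ μ : Fin P.d, ∑ ν : Fin P.d, (pdiff c ν (pdiff c μ v) x) ^ 2) :=
          mul_le_mul_of_nonneg_left hD hK0
    _ = (2197 * (24 * 289 * 24576 * 46116) : ℝ) * ((P.L : ℝ) ^ k) ^ 4 * ∑ x : Site P 0, (laplace c v x) ^ 2 := by
          rw [hE, h3d, hcast]; ring

/-- ★★★ **(D1-glob), COMPONENT FORM** for vector-valued fields: for any `ℝ`-linear reading `π : V →ₗ[ℝ] ℝ` of a `V`-valued site function vanishing on the centres,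
`c⁴·Σ_x π(v x)² ≤ C_G·(L^k)⁴·Σ_x π((laplace c v) x)²` (the scalar theorem for `π ∘ v`; `laplace` is `ℝ`-linear pointwise).  Summing over an orthonormal∕entry basis gives the
Frobenius∕Euclidean forms the consumers use. [cite: Giaquinta1984, Ch. III §1 Thm 1.2 pp.70–72] -/
theorem sum_sq_map_le_laplace_sq_of_vanish_centres (hd : P.d = 3) {k : ℕ} (hk : k ≤ P.m + P.K) (c : ℝ)
    {V : Type*} [AddCommGroup V] [Module ℝ V] (π : V →ₗ[ℝ] ℝ) (v : SiteField P 0 V) (h0 : ∀ y : Site P k, v (embIter k y) = 0) :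
    c ^ 4 * ∑ x : Site P 0, (π (v x)) ^ 2
      ≤ (2197 * (24 * 289 * 24576 * 46116) : ℝ) * ((P.L : ℝ) ^ k) ^ 4 * ∑ x : Site P 0, (π (laplace c v x)) ^ 2 := by
  have h := sum_sq_le_laplace_sq_of_vanish_centres hd hk c (fun x => π (v x)) fun y => by simp [h0 y]
  have e : ∀ x, laplace c (fun x => π (v x)) x = π (laplace c v x) := by
    intro x
    simp only [laplace, map_sum, map_smul, map_add, map_sub, smul_eq_mul]
  simp only [e] at h
  exact h


/-- ★★★ **(D1-glob) IN THE CONSUMER'S DISPLAYED SHAPE** (ym-routeR-w6 g5 (D2′) `weighted_laplace_le`, hypothesis `hP`, at level `0` with `C := range (embIter k)`): for a nonzero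
lattice factor `c`, `∀ v, (∀ y ∈ range (embIter k), v y = 0) → Σ_x v(x)² ≤ (C_G∕c⁴)·(L^k)⁴·Σ_x (laplace c v)(x)²`. [cite: Giaquinta1984, Ch. III §1 Thm 1.2 pp.70–72] -/
theorem sum_sq_le_laplace_sq_of_vanish_on_range (hd : P.d = 3) {k : ℕ} (hk : k ≤ P.m + P.K) {c : ℝ} (hc : c ≠ 0) :
    ∀ v : SiteField P 0 ℝ, (∀ y ∈ Set.range (embIter k), v y = 0) →
      ∑ x : Site P 0, (v x) ^ 2 ≤ ((2197 * (24 * 289 * 24576 * 46116) : ℝ) / c ^ 4) * ((P.L : ℝ) ^ k) ^ 4 * ∑ x : Site P 0, (laplace c v x) ^ 2 := by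
  intro v hv
  have h := sum_sq_le_laplace_sq_of_vanish_centres hd hk c v fun y => hv _ ⟨y, rfl⟩
  have hc4 : 0 < c ^ 4 := by positivity
  rw [div_mul_eq_mul_div, div_mul_eq_mul_div, le_div_iff₀ hc4]
  linarith

end Summit.QuantumFields.YangMills.Theorems.Prop7CentrePinnedHessianPoincare

end
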